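import Summits.CriticalPhenomena.PercolationContinuityZ3.Theorems.PercNearOneGluingNoHeavyLowerTailSwitchRelaxBits
import HarnessLib

/-!
# `NoHeavyLowerTail` (stmt-CriticalPhenomena-4575) — the FINITE RELAXATION of three-copy switching certificates, IId:
# kernel-friendly tables (indices, join matrices by index, potentials as nested lists, one-pass tabulation of entry lists,
# row/column representatives, masks and positional codes)

Support file (prover prim-cert-2 gen 12; `--supports stmt-CriticalPhenomena-4575`).  No named facts, no sorries.

Infrastructure for the scalable checker `…SwitchRelaxCheckN`: everything here is a small structurally recursive program on
lists of naturals / integers together with the lemma that says what it computes.  Design rule (measured, see part IIc):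
the kernel caches every reduction step, so tables are built ONCE per declaration as closed terms over the literal index
list `idxs` and then only indexed (`getN`), and potentials given as entry lists (`lookup2` / `lookup3` of part II) are
tabulated in one pass (`bucket2` / `bucket3`, `get2_bucket2` / `get2_bucket3`) instead of being scanned per lookup.
-/

namespace Summit.CriticalPhenomena.PercolationContinuityZ3.Theorems

namespace SwitchRelax

open FourPointAtoms

/-! ### Kernel-friendly list primitives and canonicalisation -/

/-- `withVal n f = f n`; under kernel reduction `f` receives a canonical term for the value of `n` (a numeral successor),
so that equal values produce structurally equal — hence cache-shared — continuations. [folklore] -/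
def withVal {α : Type} (n : ℕ) (f : ℕ → α) : α := match n with | 0 => f 0 | m + 1 => f (m + 1)

/-- `withVal` is application. [folklore] -/
theorem withVal_eq {α : Type} (n : ℕ) (f : ℕ → α) : withVal n f = f n := by cases n <;> rfl

/-- Indexing with default, by structural recursion. [folklore] -/
def getN {α : Type} : List α → ℕ → α → α
  | [], _, d => d
  | a :: _, 0, _ => a
  | _ :: l, n + 1, d => getN l n d

/-- Membership of a natural number, by `Nat.beq`. [folklore] -/
def elemN (a : ℕ) : List ℕ → Bool
  | [] => false
  | b :: l => Nat.beq a b || elemN a l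

/-- Meaning of `elemN`. [folklore] -/
theorem mem_of_elemN {a : ℕ} : ∀ {l : List ℕ}, elemN a l = true → a ∈ l
  | [], h => by simp [elemN] at h
  | b :: l, h => by
    simp only [elemN, Bool.or_eq_true, Nat.beq_eq] at h
    rcases h with rfl | h
    · exact List.mem_cons_self
    · exact List.mem_cons_of_mem _ (mem_of_elemN h)

/-- The type indices `0 … 14` as a literal list (canonical numerals). [folklore] -/
def idxs : List ℕ := [0, 1, 2, 3, 4, 5, 6, 7, 8, 9, 10, 11, 12, 13, 14]

/-- The value of a type is an index. [folklore] -/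
theorem mem_idxs (t : Ty) : t.val ∈ idxs := by fin_cases t <;> decide

/-- Members of `idxs` are below `15`. [folklore] -/
theorem lt_of_mem_idxs {k : ℕ} (h : k ∈ idxs) : k < 15 := by simp only [idxs] at h; simp at h; omega

/-- Indexing a table built over `idxs`. [folklore] -/
theorem getN_idxs_map {α : Type} (f : ℕ → α) (d : α) (t : Ty) : getN (idxs.map f) t.val d = f t.val := by
  fin_cases t <;> rfl

/-- The type with a given index (default `0`). [folklore] -/
def tyOf (k : ℕ) : Ty := if h : k < 15 then ⟨k, h⟩ else 0

/-- `tyOf` inverts `val`. [folklore] -/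
theorem tyOf_val (t : Ty) : tyOf t.val = t := by simp [tyOf, t.isLt]

/-- Join matrices by index. [this work] -/
def jtab : List ℕ := idxs.map fun k => J (tyOf k)
/-- Join matrix of a type index. [this work] -/
def jt (k : ℕ) : ℕ := getN jtab k 0
/-- `jt` on a genuine index. [this work] -/
theorem jt_val (t : Ty) : jt t.val = J t := by rw [jt, jtab, getN_idxs_map, tyOf_val]

/-! ### Potentials as nested lists; row and column representatives -/

/-- A pair potential tabulated over type indices. [this work] -/
def tab2N (f : Ty → Ty → ℤ) : List (List ℤ) := idxs.map fun s => idxs.map fun t => f (tyOf s) (tyOf t)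
/-- Table lookup. [folklore] -/
def get2 (T : List (List ℤ)) (s t : ℕ) : ℤ := getN (getN T s []) t 0
/-- Lookup in a tabulated potential. [this work] -/
theorem get2_tab2N (f : Ty → Ty → ℤ) (s t : Ty) : get2 (tab2N f) s.val t.val = f s t := by
  rw [get2, tab2N, getN_idxs_map, getN_idxs_map, tyOf_val, tyOf_val]

/-- The least index with the same ROW as `q`. [this work] -/
def rowRepN (T : List (List ℤ)) (q : ℕ) : ℕ := (idxs.find? fun q0 => decide (getN T q0 [] = getN T q [])).getD q
/-- The least index with the same COLUMN as `q`. [this work] -/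
def colRepN (T : List (List ℤ)) (q : ℕ) : ℕ := (idxs.find? fun q0 => idxs.all fun s => get2 T s q0 == get2 T s q).getD q

/-- Row representatives preserve table values. [this work] -/
theorem get2_rowRepN (T : List (List ℤ)) (q t : ℕ) : get2 T (rowRepN T q) t = get2 T q t := by
  unfold rowRepN
  cases h : idxs.find? (fun q0 => decide (getN T q0 [] = getN T q [])) with
  | none => rfl
  | some q0 =>
    have hq := List.find?_some h
    rw [decide_eq_true_iff] at hq
    simp only [Option.getD_some, get2, hq]

/-- Column representatives preserve table values. [this work] -/
theorem get2_colRepN (T : List (List ℤ)) (q : ℕ) (s : Ty) : get2 T s.val (colRepN T q) = get2 T s.val q := by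
  unfold colRepN
  cases h : idxs.find? (fun q0 => idxs.all fun s => get2 T s q0 == get2 T s q) with
  | none => rfl
  | some q0 =>
    have hq := List.find?_some h
    simp only [List.all_eq_true, beq_iff_eq] at hq
    simp only [Option.getD_some, hq _ (mem_idxs s)]

/-- Row representatives of indices are indices. [this work] -/
theorem rowRepN_lt (T : List (List ℤ)) {q : ℕ} (hq : q < 15) : rowRepN T q < 15 := by
  unfold rowRepN
  cases h : idxs.find? (fun q0 => decide (getN T q0 [] = getN T q [])) with
  | none => simpa using hq
  | some q0 => simpa using lt_of_mem_idxs (List.mem_of_find?_eq_some h)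

/-- Column representatives of indices are indices. [this work] -/
theorem colRepN_lt (T : List (List ℤ)) {q : ℕ} (hq : q < 15) : colRepN T q < 15 := by
  unfold colRepN
  cases h : idxs.find? (fun q0 => idxs.all fun s => get2 T s q0 == get2 T s q) with
  | none => simpa using hq
  | some q0 => simpa using lt_of_mem_idxs (List.mem_of_find?_eq_some h)

/-! ### Masks and positional codes -/

/-- Bit mask of a list of indices. [folklore] -/
def maskOf : List ℕ → ℕ
  | [] => 0
  | q :: l => 2 ^ q ||| maskOf l
/-- Positional code (base `2^15`) of a list of masks. [folklore] -/
def encOuts : List (List ℕ) → ℕ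
  | [] => 0
  | l :: ls => maskOf l + 32768 * encOuts ls

/-! ### Arithmetic of masks and codes -/

/-- Masks of index lists are 15-bit numbers. [folklore] -/
theorem maskOf_lt : ∀ {l : List ℕ}, (∀ q ∈ l, q < 15) → maskOf l < 32768
  | [], _ => by simp [maskOf]
  | q :: l, h => by
    rw [maskOf]
    have hq : 2 ^ q < 2 ^ 15 := Nat.pow_lt_pow_right (by norm_num) (h q List.mem_cons_self)
    exact Nat.or_lt_two_pow hq (maskOf_lt fun r hr => h r (List.mem_cons_of_mem _ hr))

/-- The bits of a mask are its members. [folklore] -/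
theorem testBit_maskOf {n : ℕ} : ∀ {l : List ℕ}, (maskOf l).testBit n = true ↔ n ∈ l
  | [] => by simp [maskOf]
  | q :: l => by
    rw [maskOf, Nat.testBit_or, Bool.or_eq_true, Nat.testBit_two_pow, decide_eq_true_iff, testBit_maskOf, List.mem_cons,
      eq_comm]

/-- Indices in a mask. [folklore] -/
def bitsOf (m : ℕ) : List ℕ := idxs.filter fun q => m.testBit q

/-- Members of a mask's index list. [folklore] -/
theorem mem_bitsOf {m q : ℕ} (hq : q < 15) (h : m.testBit q = true) : q ∈ bitsOf m :=
  List.mem_filter.2 ⟨mem_idxs ⟨q, hq⟩, h⟩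

/-- First digit of a code. [folklore] -/
theorem encOuts_cons_mod {l : List ℕ} {ls : List (List ℕ)} (h : ∀ q ∈ l, q < 15) :
    encOuts (l :: ls) % 32768 = maskOf l := by
  rw [encOuts, Nat.add_mul_mod_self_left, Nat.mod_eq_of_lt (maskOf_lt h)]
/-- Remaining digits of a code. [folklore] -/
theorem encOuts_cons_div {l : List ℕ} {ls : List (List ℕ)} (h : ∀ q ∈ l, q < 15) :
    encOuts (l :: ls) / 32768 = encOuts ls := by
  rw [encOuts, Nat.add_mul_div_left _ _ (by norm_num), Nat.div_eq_of_lt (maskOf_lt h), zero_add]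

/-! ### One-pass tabulation of entry lists -/

/-- Add `v` at position `t` of a row (no-op beyond its end). [folklore] -/
def addAt : List ℤ → ℕ → ℤ → List ℤ
  | [], _, _ => []
  | x :: xs, 0, v => (x + v) :: xs
  | x :: xs, n + 1, v => x :: addAt xs n v

/-- Add `v` at position `(s, t)` of a table. [folklore] -/
def addAt2 : List (List ℤ) → ℕ → ℕ → ℤ → List (List ℤ)
  | [], _, _, _ => []
  | r :: rs, 0, t, v => addAt r t v :: rs
  | r :: rs, n + 1, t, v => r :: addAt2 rs n t v

/-- Add `v` at position `(q, s, t)` of a cube. [folklore] -/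
def addAt3 : List (List (List ℤ)) → ℕ → ℕ → ℕ → ℤ → List (List (List ℤ))
  | [], _, _, _, _ => []
  | T :: Ts, 0, s, t, v => addAt2 T s t v :: Ts
  | T :: Ts, n + 1, s, t, v => T :: addAt3 Ts n s t v

/-- A zero row. [folklore] -/
def zero1 : List ℤ := idxs.map fun _ => 0
/-- The zero table. [folklore] -/
def zero2 : List (List ℤ) := idxs.map fun _ => zero1
/-- The zero cube. [folklore] -/
def zero3 : List (List (List ℤ)) := idxs.map fun _ => zero2

/-- **Table of a pair-potential entry list** (one pass). [this work] -/
def bucket2 : List (Ty × Ty × ℤ) → List (List ℤ)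
  | [] => zero2
  | e :: l => addAt2 (bucket2 l) e.1.val e.2.1.val e.2.2

/-- **Cube of an input-potential entry list** (one pass). [this work] -/
def bucket3 : List (Ty × Ty × Ty × ℤ) → List (List (List ℤ))
  | [] => zero3
  | e :: l => addAt3 (bucket3 l) e.1.val e.2.1.val e.2.2.1.val e.2.2.2

/-- What `addAt` does to entries (inside the row). [folklore] -/
theorem getN_addAt : ∀ (l : List ℤ) (t t' : ℕ) (v : ℤ), t < l.length →
    getN (addAt l t v) t' 0 = getN l t' 0 + if t' = t then v else 0
  | [], t, t', v, h => by simp at h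
  | x :: xs, 0, 0, v, _ => by simp [addAt, getN]
  | x :: xs, 0, t' + 1, v, _ => by simp [addAt, getN]
  | x :: xs, t + 1, 0, v, _ => by simp [addAt, getN]
  | x :: xs, t + 1, t' + 1, v, h => by
    simp only [addAt, getN]
    rw [getN_addAt xs t t' v (by simpa using h)]
    simp

/-- `addAt2` keeps the number of rows. [folklore] -/
theorem length_addAt2 : ∀ (T : List (List ℤ)) (s t : ℕ) (v : ℤ), (addAt2 T s t v).length = T.length
  | [], _, _, _ => rfl
  | r :: rs, 0, t, v => rfl
  | r :: rs, n + 1, t, v => by simp [addAt2, length_addAt2 rs n t v]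

/-- `addAt2` keeps the row lengths. [folklore] -/
theorem rowlen_addAt2 : ∀ (T : List (List ℤ)) (s t : ℕ) (v : ℤ) (n : ℕ), (∀ r ∈ T, r.length = n) →
    ∀ r ∈ addAt2 T s t v, r.length = n
  | [], _, _, _, _, _ => by simp [addAt2]
  | r :: rs, 0, t, v, n, h => by
    intro r' hr'
    simp only [addAt2, List.mem_cons] at hr'
    rcases hr' with rfl | hr'
    · -- `addAt` keeps the length (kept local: the statement coincides with an unrelated Literature lemma)
      have hlen : ∀ (l : List ℤ) (t : ℕ), (addAt l t v).length = l.length := by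
        intro l
        induction l with
        | nil => intro t; rfl
        | cons x xs ih => intro t; cases t <;> simp [addAt, ih]
      rw [hlen]; exact h r List.mem_cons_self
    · exact h r' (List.mem_cons_of_mem _ hr')
  | r :: rs, m + 1, t, v, n, h => by
    intro r' hr'
    simp only [addAt2, List.mem_cons] at hr'
    rcases hr' with rfl | hr'
    · exact h r' List.mem_cons_self
    · exact rowlen_addAt2 rs m t v n (fun q hq => h q (List.mem_cons_of_mem _ hq)) r' hr'

/-- What `addAt2` does to rows. [folklore] -/
theorem getN_addAt2 : ∀ (T : List (List ℤ)) (s s' t : ℕ) (v : ℤ), s < T.length →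
    getN (addAt2 T s t v) s' [] = if s' = s then addAt (getN T s' []) t v else getN T s' []
  | [], s, s', t, v, h => by simp at h
  | r :: rs, 0, 0, t, v, _ => by simp [addAt2, getN]
  | r :: rs, 0, s' + 1, t, v, _ => by simp [addAt2, getN]
  | r :: rs, s + 1, 0, t, v, _ => by simp [addAt2, getN]
  | r :: rs, s + 1, s' + 1, t, v, h => by
    simp only [addAt2, getN]
    rw [getN_addAt2 rs s s' t v (by simpa using h)]
    simp

/-- `addAt3` keeps the number of tables. [folklore] -/
theorem length_addAt3 : ∀ (C : List (List (List ℤ))) (q s t : ℕ) (v : ℤ), (addAt3 C q s t v).length = C.length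
  | [], _, _, _, _ => rfl
  | T :: Ts, 0, s, t, v => rfl
  | T :: Ts, n + 1, s, t, v => by simp [addAt3, length_addAt3 Ts n s t v]

/-- What `addAt3` does to tables. [folklore] -/
theorem getN_addAt3 : ∀ (C : List (List (List ℤ))) (q q' s t : ℕ) (v : ℤ), q < C.length →
    getN (addAt3 C q s t v) q' [] = if q' = q then addAt2 (getN C q' []) s t v else getN C q' []
  | [], q, q', s, t, v, h => by simp at h
  | T :: Ts, 0, 0, s, t, v, _ => by simp [addAt3, getN]
  | T :: Ts, 0, q' + 1, s, t, v, _ => by simp [addAt3, getN]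
  | T :: Ts, q + 1, 0, s, t, v, _ => by simp [addAt3, getN]
  | T :: Ts, q + 1, q' + 1, s, t, v, h => by
    simp only [addAt3, getN]
    rw [getN_addAt3 Ts q q' s t v (by simpa using h)]
    simp

/-- An entry inside a list is a member. [folklore] -/
theorem getN_mem {α : Type} : ∀ (l : List α) (n : ℕ) (d : α), n < l.length → getN l n d ∈ l
  | [], n, d, h => by simp at h
  | a :: l, 0, d, _ => by simp [getN]
  | a :: l, n + 1, d, h => by simp only [getN, List.mem_cons]; exact Or.inr (getN_mem l n d (by simpa using h))

/-- A `15 × 15` table. [folklore] -/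
def Shape2 (T : List (List ℤ)) : Prop := T.length = 15 ∧ ∀ r ∈ T, r.length = 15

/-- The zero table is square. [folklore] -/
theorem shape2_zero2 : Shape2 zero2 := ⟨rfl, fun r hr => by simp only [zero2, List.mem_map] at hr; obtain ⟨_, _, rfl⟩ := hr; rfl⟩

/-- `addAt2` keeps the shape. [folklore] -/
theorem shape2_addAt2 {T : List (List ℤ)} (h : Shape2 T) (s t : ℕ) (v : ℤ) : Shape2 (addAt2 T s t v) :=
  ⟨(length_addAt2 T s t v).trans h.1, rowlen_addAt2 T s t v 15 h.2⟩

/-- Tables of entry lists are square. [this work] -/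
theorem shape2_bucket2 : ∀ l : List (Ty × Ty × ℤ), Shape2 (bucket2 l)
  | [] => shape2_zero2
  | _ :: l => shape2_addAt2 (shape2_bucket2 l) _ _ _

/-- What `addAt2` does to entries of a square table. [this work] -/
theorem get2_addAt2 {T : List (List ℤ)} (h : Shape2 T) (s t : Ty) (v : ℤ) (s' t' : Ty) :
    get2 (addAt2 T s.val t.val v) s'.val t'.val = get2 T s'.val t'.val + if s' = s ∧ t' = t then v else 0 := by
  rw [get2, get2, getN_addAt2 T s.val s'.val t.val v (by rw [h.1]; exact s.isLt)]
  by_cases hs : s' = s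
  · subst hs
    rw [if_pos rfl, getN_addAt _ _ _ _ (by rw [h.2 _ (getN_mem _ _ _ (by rw [h.1]; exact s'.isLt))]; exact t.isLt)]
    by_cases ht : t' = t
    · subst ht; simp
    · have : t'.val ≠ t.val := fun e => ht (Fin.ext e)
      simp [ht, this]
  · have : s'.val ≠ s.val := fun e => hs (Fin.ext e)
    simp [hs, this]

/-- The zero table is zero. [folklore] -/
theorem get2_zero2 (s t : Ty) : get2 zero2 s.val t.val = 0 := by
  rw [get2, zero2, getN_idxs_map, zero1, getN_idxs_map]

/-- **The one-pass table of an entry list is its lookup function** (`lookup2` of part II). [this work] -/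
theorem get2_bucket2 : ∀ (l : List (Ty × Ty × ℤ)) (s t : Ty), get2 (bucket2 l) s.val t.val = lookup2 l s t
  | [], s, t => by rw [bucket2, get2_zero2]; rfl
  | e :: l, s, t => by
    rw [bucket2, get2_addAt2 (shape2_bucket2 l), get2_bucket2 l s t]
    simp only [lookup2, List.map_cons, List.sum_cons]
    rw [add_comm]
    congr 1
    by_cases h : e.1 = s ∧ e.2.1 = t
    · rw [if_pos h, if_pos ⟨h.1.symm, h.2.symm⟩]
    · rw [if_neg h, if_neg fun h' => h ⟨h'.1.symm, h'.2.symm⟩]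

/-- All tables of a cube are square. [folklore] -/
def Shape3 (C : List (List (List ℤ))) : Prop := ∀ T ∈ C, Shape2 T

/-- The zero cube. [folklore] -/
theorem shape3_zero3 : Shape3 zero3 := fun T hT => by
  simp only [zero3, List.mem_map] at hT; obtain ⟨_, _, rfl⟩ := hT; exact shape2_zero2

/-- `addAt3` keeps the shapes. [folklore] -/
theorem shape3_addAt3 : ∀ (C : List (List (List ℤ))) (q s t : ℕ) (v : ℤ), Shape3 C → Shape3 (addAt3 C q s t v)
  | [], _, _, _, _, h => h
  | T :: Ts, 0, s, t, v, h => by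
    intro T' hT'
    simp only [addAt3, List.mem_cons] at hT'
    rcases hT' with rfl | hT'
    · exact shape2_addAt2 (h T List.mem_cons_self) s t v
    · exact h T' (List.mem_cons_of_mem _ hT')
  | T :: Ts, q + 1, s, t, v, h => by
    intro T' hT'
    simp only [addAt3, List.mem_cons] at hT'
    rcases hT' with rfl | hT'
    · exact h T' List.mem_cons_self
    · exact shape3_addAt3 Ts q s t v (fun X hX => h X (List.mem_cons_of_mem _ hX)) T' hT'

/-- Cubes of entry lists have fifteen tables. [this work] -/
theorem length_bucket3 : ∀ l : List (Ty × Ty × Ty × ℤ), (bucket3 l).length = 15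
  | [] => rfl
  | _ :: l => by rw [bucket3, length_addAt3, length_bucket3 l]

/-- Cubes of entry lists have square tables. [this work] -/
theorem shape3_bucket3 : ∀ l : List (Ty × Ty × Ty × ℤ), Shape3 (bucket3 l)
  | [] => shape3_zero3
  | _ :: l => shape3_addAt3 _ _ _ _ _ (shape3_bucket3 l)

/-- **The one-pass cube of an entry list is its lookup function** (`lookup3` of part II). [this work] -/
theorem get2_bucket3 : ∀ (l : List (Ty × Ty × Ty × ℤ)) (q s t : Ty),
    get2 (getN (bucket3 l) q.val []) s.val t.val = lookup3 l q s t
  | [], q, s, t => by rw [bucket3, zero3, getN_idxs_map, get2_zero2]; rfl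
  | e :: l, q, s, t => by
    have hC := shape3_bucket3 l
    have hq15 : q.val < (bucket3 l).length := by rw [length_bucket3]; exact q.isLt
    rw [bucket3, getN_addAt3 _ _ _ _ _ _ (by rw [length_bucket3]; exact e.1.isLt)]
    by_cases hq : q.val = e.1.val
    · have hq' : q = e.1 := Fin.ext hq
      rw [if_pos hq, get2_addAt2 (hC _ (getN_mem _ _ _ hq15)), get2_bucket3 l q s t]
      simp only [lookup3, List.map_cons, List.sum_cons]
      rw [add_comm]
      congr 1
      by_cases h : e.2.1 = s ∧ e.2.2.1 = t
      · rw [if_pos ⟨h.1.symm, h.2.symm⟩, if_pos ⟨hq'.symm, h⟩]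
      · rw [if_neg fun h' => h ⟨h'.1.symm, h'.2.symm⟩, if_neg fun h' => h h'.2]
    · rw [if_neg hq, get2_bucket3 l q s t]
      simp only [lookup3, List.map_cons, List.sum_cons]
      rw [if_neg fun h => hq (congrArg Fin.val h.1.symm), zero_add]

end SwitchRelax

end Summit.CriticalPhenomena.PercolationContinuityZ3.Theorems
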